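import Summits.NavierStokesRegularity.NavierStokesRegularity.Theorems.TerminalTraceTypeITraceScarL3HalfSpaceStrip
import Summits.NavierStokesRegularity.NavierStokesRegularity.Theorems.TerminalTraceTypeITraceScarL3LateBoundedLiouville
import Summits.NavierStokesRegularity.NavierStokesRegularity.Theorems.TerminalTraceTypeITraceScarL3ApexZoomLimitTools
import HarnessLib

/-!
# HALF-SPACE LIOUVILLE (stub Z2 `stub_halfSpaceLiouville` of the line `radius_dichotomy`, item
# `TerminalTrace.TypeITraceScarL3`, stmt-NavierStokesRegularity-18385)

Seat nsreg-C26-p1 g5 (cell ns-regularity-ideate), `--supports stmt-NavierStokesRegularity-18385`; memo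
`HOME/nsreg-C26-p1-LOUD-ZOOM-18385.md` §4 Z2, skeleton `Cruxes/TypeITraceScarL3/Lines/radius_dichotomy_CANDIDATE.lean` (v5.1).

`halfSpaceLiouville`: an extinct Type-I apex of class `(M, D₀, C)` (suitable in every `Q_a(0)`, Type-I bound, local pressure
bound, the a.e. rate `C/√(-s)`, weak vanishing at the top time) which is a.e. bounded on a late HALF-SPACE slab
`]-δ, 0[ × {⟨y, e⟩ > 1}` vanishes a.e. on every `Q_a(0)`.

Proof. (1) RESCALE by `λ = min(1, √(δ/2))` (`U' = λU(λ²·, λ·)`, `P' = λ²P(λ²·, λ·)`; the class is scale invariant: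
`IsSuitableWeakSolutionInBall.zoomOut`, `cknD_nsZoom`, `weakNull_nsZoom`, the rate by hand): `U'` is bounded by `λK` a.e. on
`]-2, 0[ × {⟨y, e⟩ > 1/λ}`. (2) FAR FIELD: `halfSpace_farField_representative` — a smooth representative on
`]-1, 0[ × {⟨y, e⟩ > 1/λ + 1}` with vanishing vorticity beyond `1/λ + 2` (ESS backward uniqueness on the half-space,
`farField_curl_eq_zero_halfSpace`). (3) STRIPS `]-1/2, -1/(n+3)[`: there `U'` is globally a.e. bounded by the rate
(`ae_prod_norm_le_of_rate`), so `strip_ae_bound_of_halfSpace_farField` (unique continuation through the hyperplanes, bounded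
Liouville, the constant read off in the far half-space) gives `‖U'(s, ·)‖ ≤ λK` a.e. for a.e. `s` in the strip; union over
`n`, Fubini (`ae_prod_norm_le_of_ae_slices`): `‖U'‖ ≤ λK` a.e. on `]-1/2, 0[ × ℝ³`. (4) UNDO the scaling: `‖U‖ ≤ K` a.e. on
`]-λ²/2, 0[ × ℝ³`, and the LATE BOUNDED LIOUVILLE theorem `lateBoundedLiouville` (stub Z1) ends the proof.
WHAT THIS IS NOT: 18385 / NS regularity NOT proved; Z4 remains. [cite: EscauriazaSereginSverak2003, §3, Thms. 4.1, 5.1; Seregin2014, §6.6]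
-/

noncomputable section

set_option linter.dupNamespace false

namespace Summit.NavierStokesRegularity.NavierStokesRegularity.Theorems.TypeITraceScarL3

open MeasureTheory TopologicalSpace Set Function Filter Metric
open _root_.Topology
open Literature.Analysis.FluidPDE
open scoped ENNReal NNReal InnerProductSpace RealInnerProductSpace

/-- If `uncurry U` is a.e. strongly measurable on `S × ℝ³` and for a.e. `s ∈ S` the slice `U(s, ·)` is
a.e. bounded by `L`, then `‖U‖ ≤ L` a.e. on `S × ℝ³` (Fubini through a strongly measurable representative; the a.e.-slice
form of `ae_prod_norm_le_of_slices`, no measurability of `S` needed). [folklore] -/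
theorem ae_prod_norm_le_of_ae_slices
    {U : ℝ → EuclideanSpace ℝ (Fin 3) → EuclideanSpace ℝ (Fin 3)} {S : Set ℝ}
    (hU : AEStronglyMeasurable (uncurry U)
      (volume.restrict (S ×ˢ (univ : Set (EuclideanSpace ℝ (Fin 3))))))
    {L : ℝ} (h : ∀ᵐ s ∂(volume.restrict S), ∀ᵐ y : EuclideanSpace ℝ (Fin 3), ‖U s y‖ ≤ L) :
    ∀ᵐ z ∂(volume.restrict (S ×ˢ (univ : Set (EuclideanSpace ℝ (Fin 3))))), ‖U z.1 z.2‖ ≤ L := by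
  obtain ⟨V, hVm, hUV⟩ := hU
  have hprod : (volume.restrict (S ×ˢ (univ : Set (EuclideanSpace ℝ (Fin 3))))) =
      ((volume : Measure ℝ).restrict S).prod
        ((volume : Measure (EuclideanSpace ℝ (Fin 3))).restrict univ) := by
    rw [Measure.prod_restrict, ← Measure.volume_eq_prod]
  have hE : MeasurableSet {z : ℝ × EuclideanSpace ℝ (Fin 3) | ‖V z‖ ≤ L} :=
    measurableSet_le hVm.norm.measurable measurable_const
  have h1 : ∀ᵐ s ∂((volume : Measure ℝ).restrict S),
      ∀ᵐ y ∂((volume : Measure (EuclideanSpace ℝ (Fin 3))).restrict univ),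
        uncurry U (s, y) = V (s, y) := by
    have := hUV
    rw [hprod] at this
    exact Measure.ae_ae_of_ae_prod this
  have h2 : ∀ᵐ s ∂((volume : Measure ℝ).restrict S),
      ∀ᵐ y ∂((volume : Measure (EuclideanSpace ℝ (Fin 3))).restrict univ),
        (s, y) ∈ {z : ℝ × EuclideanSpace ℝ (Fin 3) | ‖V z‖ ≤ L} := by
    filter_upwards [h1, h] with s hs h3
    rw [Measure.restrict_univ] at hs ⊢
    filter_upwards [hs, h3] with y hy hy'
    show ‖V (s, y)‖ ≤ L
    rw [← hy]
    exact hy'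
  have h4 : ∀ᵐ z ∂(volume.restrict (S ×ˢ (univ : Set (EuclideanSpace ℝ (Fin 3))))),
      z ∈ {z : ℝ × EuclideanSpace ℝ (Fin 3) | ‖V z‖ ≤ L} := by
    rw [hprod]
    exact (Measure.ae_prod_mem_iff_ae_ae_mem hE).2 h2
  filter_upwards [h4, hUV] with z hz hzV
  have : ‖uncurry U z‖ ≤ L := by rw [hzV]; exact hz
  exact this

/-- A field which is suitable in every `Q_a(0)` is a.e. strongly measurable on every slab `]a, 0[ × ℝ³` (the slab is
covered by the parabolic balls `Q_{n+1}(0)`). [folklore] -/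
theorem aestronglyMeasurable_uncurry_lateSlab
    {U : ℝ → EuclideanSpace ℝ (Fin 3) → EuclideanSpace ℝ (Fin 3)} {P : ℝ → EuclideanSpace ℝ (Fin 3) → ℝ}
    (hsw : ∀ a : ℝ, 0 < a →
      IsSuitableWeakSolutionInBall a (0 : ℝ × EuclideanSpace ℝ (Fin 3)) U P) {a : ℝ} :
    AEStronglyMeasurable (uncurry U)
      (volume.restrict (Ioo a 0 ×ˢ (univ : Set (EuclideanSpace ℝ (Fin 3))))) := by
  have hcover : Ioo a 0 ×ˢ (univ : Set (EuclideanSpace ℝ (Fin 3))) ⊆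
      ⋃ n : ℕ, parabolicCylinder ((n : ℝ) + 1) (0 : ℝ × EuclideanSpace ℝ (Fin 3)) := by
    rintro ⟨s, y⟩ ⟨hs, -⟩
    obtain ⟨n, hn⟩ := exists_nat_ge (max (-s) ‖y‖)
    have h1 : -s ≤ n := (le_max_left _ _).trans hn
    have h2 : ‖y‖ ≤ n := (le_max_right _ _).trans hn
    have h3 : (n : ℝ) + 1 ≤ ((n : ℝ) + 1) ^ 2 := by nlinarith [n.cast_nonneg (α := ℝ)]
    refine mem_iUnion.2 ⟨n, ?_⟩
    rw [mem_parabolicCylinder]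
    exact ⟨⟨by simp only [Prod.fst_zero, zero_sub]; linarith [hs.1], by simpa using hs.2⟩,
      by simpa using (by linarith : ‖y‖ < (n : ℝ) + 1)⟩
  have hU : AEStronglyMeasurable (uncurry U)
      (volume.restrict (⋃ n : ℕ, parabolicCylinder ((n : ℝ) + 1) (0 : ℝ × EuclideanSpace ℝ (Fin 3)))) := by
    rw [aestronglyMeasurable_iUnion_iff]
    intro n
    have hn : (0 : ℝ) < (n : ℝ) + 1 := by positivity
    have h := (hsw _ hn).1.distributional.1.aestronglyMeasurable
    rw [coe_parabolicCylinderOpens] at h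
    exact h
  exact hU.mono_measure (Measure.restrict_mono hcover le_rfl)

set_option maxHeartbeats 1600000 in
/-- **Stub Z2 «HALF-SPACE LIOUVILLE»** (`stub_halfSpaceLiouville` of `Lines/radius_dichotomy_CANDIDATE.lean` v5.1, statement
VERBATIM): an extinct Type-I apex of the class which is a.e. bounded on a late half-space slab `]-δ, 0[ × {⟨y, e⟩ > 1}`
vanishes a.e. on every parabolic ball `Q_a(0)`. Proof: module docstring (rescale; ESS half-space backward uniqueness; unique
continuation + bounded Liouville on the rate-bounded strips; undo the scaling; `lateBoundedLiouville`).
[cite: EscauriazaSereginSverak2003, §3 and Thms. 4.1, 5.1] [cite: Seregin2014, §6.6] -/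
theorem halfSpaceLiouville :
    ∀ (U : ℝ → EuclideanSpace ℝ (Fin 3) → EuclideanSpace ℝ (Fin 3))
      (P : ℝ → EuclideanSpace ℝ (Fin 3) → ℝ)
      (G : ℝ → EuclideanSpace ℝ (Fin 3) →
        EuclideanSpace ℝ (Fin 3) →L[ℝ] EuclideanSpace ℝ (Fin 3))
      (M D₀ : ℝ≥0) (C : ℝ),
      (∀ a : ℝ, 0 < a →
        IsSuitableWeakSolutionInBall a (0 : ℝ × EuclideanSpace ℝ (Fin 3)) U P) →
      (∀ a : ℝ, 0 < a →
        HasWeakSpatialGradientOn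
          (parabolicCylinderOpens a (0 : ℝ × EuclideanSpace ℝ (Fin 3))) U G) →
      (∀ a : ℝ, 0 < a →
        typeIBound (parabolicCylinder a (0 : ℝ × EuclideanSpace ℝ (Fin 3))) U P G ≤ M) →
      (∀ z₀ : ℝ × EuclideanSpace ℝ (Fin 3), z₀.1 ≤ 0 →
        ∀ r : ℝ, 0 < r → cknD r z₀ P ≤ D₀) →
      (∀ s : ℝ, s < 0 →
        ∀ᵐ y : EuclideanSpace ℝ (Fin 3), ‖U s y‖ ≤ C / Real.sqrt (-s)) →
      (∀ φ : EuclideanSpace ℝ (Fin 3) → EuclideanSpace ℝ (Fin 3),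
        ContDiff ℝ (⊤ : ℕ∞) φ →
        HasCompactSupport φ → ∀ ε : ℝ, 0 < ε →
        ∃ s₀ : ℝ, s₀ < 0 ∧ ∀ᵐ s ∂(volume.restrict (Ioo s₀ 0)), |∫ y, ⟪U s y, φ y⟫| ≤ ε) →
      (∃ e : EuclideanSpace ℝ (Fin 3), ‖e‖ = 1 ∧ ∃ δ : ℝ, 0 < δ ∧ ∃ K : ℝ,
        ∀ᵐ z ∂(volume.restrict (Ioo (-δ) 0 ×ˢ {y : EuclideanSpace ℝ (Fin 3) | 1 < ⟪y, e⟫})),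
          ‖U z.1 z.2‖ ≤ K) →
      ∀ a : ℝ, 0 < a →
        ∀ᵐ z ∂(volume.restrict (parabolicCylinder a (0 : ℝ × EuclideanSpace ℝ (Fin 3)))), U z.1 z.2 = 0 := by
  intro U P G M D₀ C hsw hG hI hD hrate htop hhalf a ha
  obtain ⟨e, he, δ, hδ, K, hbd⟩ := hhalf
  -- ### `C ≥ 0` (otherwise the rate at `s = -1` is absurd)
  have hC : 0 ≤ C := by
    by_contra hC
    simp only [not_le] at hC
    have h := hrate (-1) (by norm_num)
    rw [neg_neg, Real.sqrt_one, div_one] at h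
    have hfalse : ∀ᵐ y : EuclideanSpace ℝ (Fin 3), False := by
      filter_upwards [h] with y hy
      linarith [norm_nonneg (U (-1) y)]
    rw [ae_iff] at hfalse
    simp only [not_false_eq_true, setOf_true] at hfalse
    exact NeZero.ne (volume : Measure (EuclideanSpace ℝ (Fin 3))) (Measure.measure_univ_eq_zero.mp hfalse)
  -- ### (1) the scale `λ = min(1, √(δ/2))`: `2λ² ≤ δ`
  set lam : ℝ := min 1 (Real.sqrt (δ / 2)) with hlamdef
  have hlampos : 0 < lam := lt_min one_pos (Real.sqrt_pos.2 (by positivity))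
  have hlam0 : lam ≠ 0 := hlampos.ne'
  have hlam2 : 0 < lam ^ 2 := pow_pos hlampos 2
  have hlamδ : 2 * lam ^ 2 ≤ δ := by
    have h1 : lam ≤ Real.sqrt (δ / 2) := min_le_right _ _
    have h2 : lam ^ 2 ≤ Real.sqrt (δ / 2) ^ 2 := pow_le_pow_left₀ hlampos.le h1 2
    rw [Real.sq_sqrt (by positivity)] at h2
    linarith
  -- the rescaled pair
  set U' : ℝ → EuclideanSpace ℝ (Fin 3) → EuclideanSpace ℝ (Fin 3) :=
    lam • stPull (lam ^ 2) lam (0 : ℝ) (0 : EuclideanSpace ℝ (Fin 3)) U with hU'def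
  set P' : ℝ → EuclideanSpace ℝ (Fin 3) → ℝ :=
    lam ^ 2 • stPull (lam ^ 2) lam (0 : ℝ) (0 : EuclideanSpace ℝ (Fin 3)) P with hP'def
  have hU'apply : ∀ s y, U' s y = lam • U (lam ^ 2 * s) (lam • y) := fun s y => by
    rw [hU'def]; simp only [Pi.smul_apply, stPull_apply, zero_add]
  have hst0 : ∀ z : ℝ × EuclideanSpace ℝ (Fin 3),
      stAffine (lam ^ 2) lam (0 : ℝ) (0 : EuclideanSpace ℝ (Fin 3)) z = (lam ^ 2 * z.1, lam • z.2) := by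
    intro z
    rw [show z = (z.1, z.2) from rfl, stAffine_apply, zero_add, zero_add]
  -- (i) suitable in every `Q(a)`
  have hsw' : ∀ a : ℝ, 0 < a →
      IsSuitableWeakSolutionInBall a (0 : ℝ × EuclideanSpace ℝ (Fin 3)) U' P' := by
    intro a' ha'
    have h := (hsw (a' * lam) (mul_pos ha' hlampos)).zoomOut hlampos
    rwa [mul_div_cancel_right₀ a' hlam0] at h
  -- (ii) the pressure bounds at radius `1`
  have hP' : ∀ z₀ : ℝ × EuclideanSpace ℝ (Fin 3), z₀.1 ≤ 0 →
      ∫⁻ q in parabolicCylinder 1 z₀, ‖P' q.1 q.2‖ₑ ^ (3 / 2 : ℝ) ≤ D₀ := by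
    intro z₀ hz₀
    have h1 : cknD 1 z₀ P' = cknD lam (stAffine (lam ^ 2) lam 0 0 z₀) P := by
      rw [hP'def, cknD_nsZoom hlampos one_pos 0 0 z₀ P, mul_one]
    have h2 : cknD lam (stAffine (lam ^ 2) lam 0 0 z₀) P ≤ D₀ := by
      refine hD _ ?_ lam hlampos
      rw [hst0]
      exact mul_nonpos_of_nonneg_of_nonpos hlam2.le hz₀
    have h3 : cknD 1 z₀ P' = ∫⁻ q in parabolicCylinder 1 z₀, ‖P' q.1 q.2‖ₑ ^ (3 / 2 : ℝ) := by
      rw [cknD, ENNReal.ofReal_one, one_pow, inv_one, one_mul]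
    rw [← h3, h1]
    exact h2
  -- (iii) weak vanishing at the top
  have htop' : ∀ φ : EuclideanSpace ℝ (Fin 3) → EuclideanSpace ℝ (Fin 3), ContDiff ℝ (⊤ : ℕ∞) φ →
      HasCompactSupport φ → ∀ ε : ℝ, 0 < ε →
        ∃ s₀ : ℝ, s₀ < 0 ∧ ∀ᵐ s ∂(volume.restrict (Ioo s₀ 0)), |∫ y, ⟪U' s y, φ y⟫| ≤ ε := by
    have h := weakNull_nsZoom htop hlampos
    rw [← hU'def] at h
    exact h
  -- (iv) the rate
  have hrate' : ∀ s : ℝ, s < 0 →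
      ∀ᵐ y : EuclideanSpace ℝ (Fin 3), ‖U' s y‖ ≤ C / Real.sqrt (-s) := by
    intro s hs
    have hs2 : lam ^ 2 * s < 0 := mul_neg_of_pos_of_neg hlam2 hs
    have h := (Measure.quasiMeasurePreserving_smul volume hlam0).ae (hrate (lam ^ 2 * s) hs2)
    filter_upwards [h] with y hy
    have hsq : Real.sqrt (-(lam ^ 2 * s)) = lam * Real.sqrt (-s) := by
      rw [show -(lam ^ 2 * s) = lam ^ 2 * (-s) by ring, Real.sqrt_mul hlam2.le, Real.sqrt_sq hlampos.le]
    have hpos : 0 < Real.sqrt (-s) := Real.sqrt_pos.2 (by linarith)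
    rw [hU'apply, norm_smul, Real.norm_eq_abs, abs_of_pos hlampos]
    have hy' : ‖U (lam ^ 2 * s) (lam • y)‖ ≤ C / (lam * Real.sqrt (-s)) := by rw [← hsq]; exact hy
    calc lam * ‖U (lam ^ 2 * s) (lam • y)‖ ≤ lam * (C / (lam * Real.sqrt (-s))) :=
          mul_le_mul_of_nonneg_left hy' hlampos.le
      _ = C / Real.sqrt (-s) := by field_simp
  -- (v) the far half-space bound: `‖U'‖ ≤ λK` a.e. on `]-2, 0[ × {⟨x, e⟩ > 1/λ}`
  set R₀ : ℝ := lam⁻¹ with hR₀def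
  have hH1o : IsOpen {y : EuclideanSpace ℝ (Fin 3) | 1 < ⟪y, e⟫} :=
    isOpen_lt continuous_const (continuous_id.inner continuous_const)
  have hHo : IsOpen {x : EuclideanSpace ℝ (Fin 3) | R₀ < ⟪x, e⟫} :=
    isOpen_lt continuous_const (continuous_id.inner continuous_const)
  have hfar' : ∀ᵐ z ∂(volume.restrict
      (Ioo (-2 : ℝ) 0 ×ˢ {x : EuclideanSpace ℝ (Fin 3) | R₀ < ⟪x, e⟫})), ‖U' z.1 z.2‖ ≤ lam * K := by
    have hSm : MeasurableSet (Ioo (-δ) 0 ×ˢ {y : EuclideanSpace ℝ (Fin 3) | 1 < ⟪y, e⟫}) :=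
      measurableSet_Ioo.prod hH1o.measurableSet
    have hS'm : MeasurableSet (Ioo (-2 : ℝ) 0 ×ˢ {x : EuclideanSpace ℝ (Fin 3) | R₀ < ⟪x, e⟫}) :=
      measurableSet_Ioo.prod hHo.measurableSet
    rw [ae_restrict_iff' hSm] at hbd
    rw [ae_restrict_iff' hS'm]
    filter_upwards [(quasiMeasurePreserving_parabolicDilation hlam0).ae hbd] with z hz hzS'
    obtain ⟨hz1, hz2⟩ := hzS'
    have hz2' : R₀ < ⟪z.2, e⟫ := hz2
    have hmem : ((lam ^ 2 * z.1, lam • z.2) : ℝ × EuclideanSpace ℝ (Fin 3)) ∈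
        Ioo (-δ) 0 ×ˢ {y : EuclideanSpace ℝ (Fin 3) | 1 < ⟪y, e⟫} := by
      refine ⟨⟨?_, mul_neg_of_pos_of_neg hlam2 hz1.2⟩, ?_⟩
      · nlinarith [mul_lt_mul_of_pos_left hz1.1 hlam2, hlamδ]
      · show 1 < ⟪lam • z.2, e⟫
        rw [real_inner_smul_left]
        have h := mul_lt_mul_of_pos_left hz2' hlampos
        rwa [hR₀def, mul_inv_cancel₀ hlam0] at h
    have hb := hz hmem
    rw [hU'apply, norm_smul, Real.norm_eq_abs, abs_of_pos hlampos]
    exact mul_le_mul_of_nonneg_left hb hlampos.le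
  -- ### (2) the far-field representative (ESS backward uniqueness on the half-space)
  obtain ⟨Uf, hUf, hUfc, hcurl⟩ := halfSpace_farField_representative hsw' hP' htop' he hfar'
  -- ### (3) the strips `]-1/2, -1/(n+3)[`: a.e. slice bounds
  have hstrip : ∀ n : ℕ, ∀ᵐ s ∂(volume.restrict (Ioo (-1 / 2 : ℝ) (-(1 / ((n : ℝ) + 3))))),
      ∀ᵐ y : EuclideanSpace ℝ (Fin 3), ‖U' s y‖ ≤ lam * K := by
    intro n
    have hn3 : (0 : ℝ) < (n : ℝ) + 3 := by positivity
    have hb0 : (0 : ℝ) < 1 / ((n : ℝ) + 3) := by positivity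
    have hb1 : 1 / ((n : ℝ) + 3) ≤ 1 / 3 :=
      one_div_le_one_div_of_le (by norm_num) (by linarith [n.cast_nonneg (α := ℝ)])
    have hbT : 1 / ((n : ℝ) + 3) < 3 / 4 := by linarith
    have hbd_n := ae_prod_norm_le_of_rate hsw' hrate' hC hb0 hbT
    have hK'n : ∀ᵐ z ∂(volume.restrict (Ioo (-1 / 2 : ℝ) (-(1 / ((n : ℝ) + 3))) ×ˢ
        {x : EuclideanSpace ℝ (Fin 3) | R₀ + 1 < ⟪x, e⟫})), ‖U' z.1 z.2‖ ≤ lam * K := by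
      refine ae_restrict_of_ae_restrict_of_subset
        (prod_mono (Ioo_subset_Ioo (by norm_num) (by linarith)) ?_) hfar'
      intro x hx
      show R₀ < ⟪x, e⟫
      have : R₀ + 1 < ⟪x, e⟫ := hx
      linarith
    refine strip_ae_bound_of_halfSpace_farField hsw' hP' he hUf hUfc hcurl (a := -1 / 2) (ρ := 1 / 4)
      (L := C / Real.sqrt (1 / ((n : ℝ) + 3))) (by norm_num) (by norm_num) (by norm_num) (by linarith) ?_ hK'n
    rw [show (-1 / 2 : ℝ) - 4 * (1 / 4 : ℝ) ^ 2 = -(3 / 4) by norm_num]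
    exact hbd_n
  -- union of the strips
  have hae_s : ∀ᵐ s ∂(volume.restrict (Ioo (-1 / 2 : ℝ) 0)),
      ∀ᵐ y : EuclideanSpace ℝ (Fin 3), ‖U' s y‖ ≤ lam * K := by
    have hcov : Ioo (-1 / 2 : ℝ) 0 ⊆ ⋃ n : ℕ, Ioo (-1 / 2 : ℝ) (-(1 / ((n : ℝ) + 3))) := by
      intro s hs
      have hs0 : 0 < -s := by linarith [hs.2]
      obtain ⟨n, hn⟩ := exists_nat_gt (1 / (-s))
      refine mem_iUnion.2 ⟨n, hs.1, ?_⟩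
      have hn3 : (0 : ℝ) < (n : ℝ) + 3 := by positivity
      have h3 : 1 / (-s) < (n : ℝ) + 3 := by linarith
      have h1 : 1 / ((n : ℝ) + 3) < -s := by
        rw [div_lt_iff₀ hn3, mul_comm]
        rw [div_lt_iff₀ hs0] at h3
        exact h3
      linarith
    refine ae_restrict_of_ae_restrict_of_subset hcov ?_
    rw [ae_restrict_iUnion_iff]
    exact hstrip
  -- Fubini: the product bound on `]-1/2, 0[ × ℝ³`
  have hslab' : ∀ᵐ z ∂(volume.restrict (Ioo (-1 / 2 : ℝ) 0 ×ˢ (univ : Set (EuclideanSpace ℝ (Fin 3))))),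
      ‖U' z.1 z.2‖ ≤ lam * K :=
    ae_prod_norm_le_of_ae_slices (aestronglyMeasurable_uncurry_lateSlab hsw') hae_s
  -- ### (4) undo the scaling: `‖U‖ ≤ K` a.e. on `]-λ²/2, 0[ × ℝ³`
  have hslab : ∀ᵐ z ∂(volume.restrict
      (Ioo (-(lam ^ 2 / 2)) 0 ×ˢ (univ : Set (EuclideanSpace ℝ (Fin 3))))), ‖U z.1 z.2‖ ≤ K := by
    have hSm : MeasurableSet (Ioo (-1 / 2 : ℝ) 0 ×ˢ (univ : Set (EuclideanSpace ℝ (Fin 3)))) :=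
      measurableSet_Ioo.prod MeasurableSet.univ
    have hS'm : MeasurableSet (Ioo (-(lam ^ 2 / 2)) (0 : ℝ) ×ˢ (univ : Set (EuclideanSpace ℝ (Fin 3)))) :=
      measurableSet_Ioo.prod MeasurableSet.univ
    rw [ae_restrict_iff' hSm] at hslab'
    rw [ae_restrict_iff' hS'm]
    filter_upwards [(quasiMeasurePreserving_parabolicDilation (inv_ne_zero hlam0)).ae hslab'] with z hz hzS
    have hmem : ((lam⁻¹ ^ 2 * z.1, lam⁻¹ • z.2) : ℝ × EuclideanSpace ℝ (Fin 3)) ∈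
        Ioo (-1 / 2 : ℝ) 0 ×ˢ (univ : Set (EuclideanSpace ℝ (Fin 3))) := by
      refine ⟨⟨?_, ?_⟩, mem_univ _⟩
      · rw [inv_pow, inv_mul_eq_div, lt_div_iff₀ hlam2]
        linarith [hzS.1.1]
      · rw [inv_pow]
        exact mul_neg_of_pos_of_neg (inv_pos.2 hlam2) hzS.1.2
    have hb := hz hmem
    rw [hU'apply, inv_pow, ← mul_assoc, mul_inv_cancel₀ hlam2.ne', one_mul, smul_smul,
      mul_inv_cancel₀ hlam0, one_smul, norm_smul, Real.norm_eq_abs, abs_of_pos hlampos] at hb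
    exact le_of_mul_le_mul_left hb hlampos
  -- ### the late bounded Liouville theorem (stub Z1)
  exact lateBoundedLiouville U P G M D₀ C hsw hG hI hD hrate htop ⟨lam ^ 2 / 2, by positivity, K, hslab⟩ a ha

end Summit.NavierStokesRegularity.NavierStokesRegularity.Theorems.TypeITraceScarL3

end
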